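import Literature.NumberTheory.NumberFields.RingClassFieldAbelian
import Literature.NumberTheory.NumberFields.ClassFieldsOfCharactersUniqueness
import HarnessLib

/-!
# The Artin isomorphism `Gal(R_f/K) ≃ I_K(f)/P_{K,ℤ}(f)` of the ring class field
# (Cox, *Primes of the form x² + ny²*, §9.A; Neukirch, *Algebraic Number Theory*, VI (7.1), VII (13.4))

Topic `NumberTheory/NumberFields`.  Theorem-only file (no definition, no named fact, D-0026).

Let `K` be a number field, `f ≥ 1` with finite ring class group `I_K(f)/P_{K,ℤ}(f)`
(`RingClassGroup K f`), and `R ⊆ K̄` a finite Galois extension of `K`, unramified at every `v ∤ f`,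
in which a prime `v ∤ f` splits completely iff `[𝔭_v] = 1` (the ring class field of conductor `f`,
`RingClassField.exists_abelian_ringClassField_data`; unique, `eq_of_splitPrimes_iff_primeClass_eq_one`).
Cox §9.A (p. 180): *"the Artin map … induce[s] `C(𝒪) ≃ I_K(f)/P_{K,ℤ}(f) ≃ Gal(L/K)`"*.  The file
`RingClassFieldAbelian.lean` proved this in dual form (characters of `Gal(R/K)` = characters of
`I_K(f)/P_{K,ℤ}(f)` under `θ(Frob_v) = χ([𝔭_v])`).  Here the isomorphism itself is assembled:

* `exists_galFrob_eq` — **Chebotarev, existence form, for an abelian extension**: every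
  `g ∈ Gal(L/K)` is the Frobenius `Frob_v = galFrob K L v` of infinitely many — in particular of
  some `v` outside any finite set — unramified degree-one primes `v` (the tree's
  `infinite_setOf_exists_isArithFrobAt`, Neukirch VII (13.4), with `eq_galFrob`);
* `RingClassField.exists_character_of_ringClassCharacter_galFrob` — the `χ ↦ θ_χ` half of the dual
  isomorphism in the finite-level Frobenius currency;
* `RingClassField.exists_artinEquiv` — **the Artin isomorphism**: a group isomorphism
  `art : Gal(R/K) ≃* I_K(f)/P_{K,ℤ}(f)` with `art(Frob_v) = [𝔭_v]` for every `v ∤ f`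
  (well defined and multiplicative because the characters `θ_χ` separate the values, injective by
  the splitting law, bijective by `#Gal(R/K) = #(I_K(f)/P_{K,ℤ}(f))`,
  `card_aut_eq_card_ringClassGroup_of_splitPrimes_iff`); `RingClassField.exists_artinEquiv_abs` —
  the same with Frobenius in the absolute currency (`σ ∈ Γ_K` arithmetic Frobenius at `𝔓 ∣ v`);
* `RingClassField.artinHom_unique` — a map on `Gal(R/K)` is determined by its values on the
  `Frob_v`, `v ∤ f`.

HONEST FRAMING: published, proved class field theory only (Cox §9.A, Neukirch VI–VII) on top of the
tree's proved Chebotarev and Artin reciprocity for characters; nothing specific to a summit is booked.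

## References

* D. A. Cox, *Primes of the form x² + ny²*, 2nd ed. (2013), §8.A Thm. 8.2, Cor. 8.7, §9.A
  (pp. 180–181). [Cox2013]
* J. Neukirch, *Algebraic Number Theory* (1999), Ch. VI §7 Thm. (7.1); Ch. VII §13 Thm. (13.4),
  Prop. (13.9). [NeukirchANT1999]
* D. A. Marcus, *Number Fields*, 2nd ed. (2018), Ch. 4, Thm. 32 and the remark following it. [Marcus2018]
-/

noncomputable section

open NumberField IsDedekindDomain IsDedekindDomain.HeightOneSpectrum Filter Field
open scoped nonZeroDivisors IsMulCommutative

namespace Literature.NumberTheory.NumberFields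

open Literature.NumberTheory.GaloisRepresentations Literature.NumberTheory.Automorphic
  Literature.NumberTheory.LFunctions Literature.NumberTheory.QuadraticFields.RingClass

variable {K : Type} [Field K] [NumberField K]

/-! ### Chebotarev, existence form: every element is a Frobenius -/

/-- **Every element of an abelian Galois group is a Frobenius, at a prime outside any finite set**
(Chebotarev's density theorem in its existence form, Neukirch VII (13.4): the set of primes with
prescribed Frobenius is infinite; for `L/K` abelian and `v` unramified the Frobenius at `v` is a
well-defined element `Frob_v = galFrob K L v`): for `L/K` finite Galois with commutative Galois
group, `S` a finite set of primes of `K` and `g ∈ Gal(L/K)`, there is a prime `v ∉ S`, of prime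
absolute norm and unramified in `L`, with `Frob_v = g`.
[cite: NeukirchANT1999, Ch. VII §13 Thm. (13.4)] -/
theorem exists_galFrob_eq (L : Type) [Field L] [NumberField L] [Algebra K L] [IsGalois K L]
    (hcomm : ∀ a b : L ≃ₐ[K] L, Commute a b) {S : Set (HeightOneSpectrum (𝓞 K))} (hS : S.Finite)
    (g : L ≃ₐ[K] L) :
    ∃ v : HeightOneSpectrum (𝓞 K), v ∉ S ∧ (Ideal.absNorm v.asIdeal).Prime ∧
      Algebra.IsUnramifiedIn (𝓞 L) v.asIdeal ∧ galFrob K L v = g := by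
  classical
  obtain ⟨v, ⟨hprime, hunr, Q, hQ, hfrob⟩, hvS⟩ :=
    ((infinite_setOf_exists_isArithFrobAt (F := K) (L := L) g).sdiff hS).nonempty
  exact ⟨v, hvS, hprime, hunr, (eq_galFrob hcomm hunr hQ hfrob).symm⟩

namespace RingClassField

variable (f : ℕ)

/-- Characters of a finite commutative group with values in `ℂˣ` separate points.  Private helper
(`CommGroup.exists_apply_ne_one_of_hasEnoughRootsOfUnity` with the roots of unity of `ℂ`). [folklore] -/
private theorem eq_one_of_forall_character (G : Type) [CommGroup G] [Finite G] (x : G)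
    (hx : ∀ φ : G →* ℂˣ, φ x = 1) : x = 1 := by
  haveI : NeZero ((Monoid.exponent G : ℕ) : ℂ) :=
    ⟨Nat.cast_ne_zero.mpr (Monoid.exponent_ne_zero.mpr (Monoid.ExponentExists.of_finite (G := G)))⟩
  haveI : HasEnoughRootsOfUnity ℂ (Monoid.exponent G) := inferInstance
  by_contra hne
  obtain ⟨φ, hφ⟩ := CommGroup.exists_apply_ne_one_of_hasEnoughRootsOfUnity G ℂ hne
  exact hφ (hx φ)

variable [Finite (RingClassGroup K f)]

/-- **Every ring class character is a character of `Gal(R/K)`, finite-level Frobenius** (the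
`χ ↦ θ_χ` half of the dual Artin isomorphism, `exists_character_of_ringClassCharacter`, restated with
`Frob_v = galFrob K R v`): for `R ⊆ K̄` finite Galois over `K`, unramified off `f`, in which every
`v ∤ f` with `[𝔭_v] = 1` splits completely and whose completely split `v ∤ f` have `[𝔭_v] = 1`, and
a character `χ` of `I_K(f)/P_{K,ℤ}(f)`, there is a character `θ` of `Gal(R/K)` with
`θ(Frob_v) = χ([𝔭_v])` for all `v ∤ f`. [cite: Cox2013, §9.A (pp. 180–181) with §8.A Thm. 8.2]
[cite: NeukirchANT1999, Ch. VI §7 Thm. (7.1)] -/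
theorem exists_character_of_ringClassCharacter_galFrob (hf : f ≠ 0)
    (R : IntermediateField K (AlgebraicClosure K)) [FiniteDimensional K R] [IsGalois K R]
    [NumberField R]
    (hunr : ∀ v : HeightOneSpectrum (𝓞 K), ¬ Ideal.span {(f : 𝓞 K)} ≤ v.asIdeal →
      Algebra.IsUnramifiedIn (𝓞 R) v.asIdeal)
    (hsplit : ∀ v : HeightOneSpectrum (𝓞 K), ¬ Ideal.span {(f : 𝓞 K)} ≤ v.asIdeal →
      (v ∈ splitPrimes K R ↔ primeClass f v = 1))
    (χ : RingClassGroup K f →* ℂˣ) :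
    ∃ θ : (R ≃ₐ[K] R) →* ℂˣ, ∀ v : HeightOneSpectrum (𝓞 K), ¬ Ideal.span {(f : 𝓞 K)} ≤ v.asIdeal →
      θ (galFrob K R v) = χ (primeClass f v) := by
  classical
  haveI : IsAbelianGalois K R :=
    isAbelianGalois_of_primeClass_eq_one_imp f hf R (fun v hv h1 => (hsplit v hv).mpr h1)
  have hcomm : ∀ a b : R ≃ₐ[K] R, Commute a b := commute_of_isAbelianGalois R
  obtain ⟨θ, hθ⟩ :=
    exists_character_of_ringClassCharacter f hf R (fun v hv h => (hsplit v hv).mp h) χ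
  refine ⟨θ, fun v hv => ?_⟩
  obtain ⟨𝔓, h𝔓⟩ := v.primesAbove_nonempty
  obtain ⟨σ, hσ⟩ := HeightOneSpectrum.exists_isArithFrobAt_of_mem_primesAbove_holds h𝔓
  haveI : 𝔓.IsPrime := h𝔓.1
  have hP := comap_ringOfIntegersToIntegralClosure_mem_primesOver_of_mem_primesAbove R h𝔓
  have hrσ := isArithFrobAt_absRestrictNormalHom R hσ
  rw [← eq_galFrob hcomm (hunr v hv) hP hrσ]
  exact hθ v hv 𝔓 h𝔓 σ hσ

/-- **A map on `Gal(R/K)` is determined by its values at the Frobenius elements `Frob_v`, `v ∤ f`**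
(every element is such a Frobenius, `exists_galFrob_eq`). [cite: NeukirchANT1999, Ch. VII §13 Thm. (13.4)] -/
theorem artinHom_unique (hf : f ≠ 0) (R : IntermediateField K (AlgebraicClosure K))
    [FiniteDimensional K R] [IsGalois K R] [NumberField R]
    (hR : ∀ v : HeightOneSpectrum (𝓞 K), ¬ Ideal.span {(f : 𝓞 K)} ≤ v.asIdeal →
      primeClass f v = 1 → v ∈ splitPrimes K R)
    {X : Type*} {φ ψ : (R ≃ₐ[K] R) → X}
    (h : ∀ v : HeightOneSpectrum (𝓞 K), ¬ Ideal.span {(f : 𝓞 K)} ≤ v.asIdeal →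
      Algebra.IsUnramifiedIn (𝓞 R) v.asIdeal → φ (galFrob K R v) = ψ (galFrob K R v)) :
    φ = ψ := by
  classical
  haveI : IsAbelianGalois K R := isAbelianGalois_of_primeClass_eq_one_imp f hf R hR
  have hcomm : ∀ a b : R ≃ₐ[K] R, Commute a b := commute_of_isAbelianGalois R
  have h𝔪 : Ideal.span {(f : 𝓞 K)} ≠ ⊥ := by
    rw [Ne, Ideal.span_singleton_eq_bot]
    exact_mod_cast hf
  funext g
  obtain ⟨v, hvS, -, hunr, hg⟩ := exists_galFrob_eq (K := K) R hcomm (finite_setOf_le_asIdeal h𝔪) g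
  rw [Set.mem_setOf_eq] at hvS
  rw [← hg]
  exact h v hvS hunr

/-- **The Artin isomorphism `Gal(R_f/K) ≃ I_K(f)/P_{K,ℤ}(f)` of the ring class field** (Cox §9.A:
*"the Artin map … induce[s] `C(𝒪) ≃ I_K(f)/P_{K,ℤ}(f) ≃ Gal(L/K)`"*; Neukirch VI (7.1)).  Let `R ⊆ K̄`
be finite Galois over `K`, unramified at every `v ∤ f`, with `v` split `⟺ [𝔭_v] = 1` for `v ∤ f`.
Then there is a group isomorphism `art : Gal(R/K) ≃* I_K(f)/P_{K,ℤ}(f)` with `art(Frob_v) = [𝔭_v]`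
for every `v ∤ f` (`Frob_v = galFrob K R v`).  Proof: every `g` is `Frob_v` for some `v ∤ f`
(Chebotarev); `g ↦ [𝔭_v]` is well defined and multiplicative because for every character `χ` of
`I_K(f)/P_{K,ℤ}(f)`, `χ([𝔭_v]) = θ_χ(Frob_v)` depends only on `Frob_v`
(`exists_character_of_ringClassCharacter_galFrob`) and the characters separate points; it is
injective by the splitting law (`[𝔭_v] = 1 ⟹ v` splits `⟹ Frob_v = 1`) and bijective since
`#Gal(R/K) = #(I_K(f)/P_{K,ℤ}(f))` (`card_aut_eq_card_ringClassGroup_of_splitPrimes_iff`).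
[cite: Cox2013, §9.A (pp. 180–181) with §8.A Thm. 8.2 and Cor. 8.7]
[cite: NeukirchANT1999, Ch. VI §7 Thm. (7.1), Ch. VII §13 Thm. (13.4)] -/
theorem exists_artinEquiv (hf : f ≠ 0) (R : IntermediateField K (AlgebraicClosure K))
    [FiniteDimensional K R] [IsGalois K R] [NumberField R]
    (hunr : ∀ v : HeightOneSpectrum (𝓞 K), ¬ Ideal.span {(f : 𝓞 K)} ≤ v.asIdeal →
      Algebra.IsUnramifiedIn (𝓞 R) v.asIdeal)
    (hsplit : ∀ v : HeightOneSpectrum (𝓞 K), ¬ Ideal.span {(f : 𝓞 K)} ≤ v.asIdeal →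
      (v ∈ splitPrimes K R ↔ primeClass f v = 1)) :
    ∃ art : (R ≃ₐ[K] R) ≃* RingClassGroup K f, ∀ v : HeightOneSpectrum (𝓞 K),
      ¬ Ideal.span {(f : 𝓞 K)} ≤ v.asIdeal → art (galFrob K R v) = primeClass f v := by
  classical
  haveI : IsAbelianGalois K R :=
    isAbelianGalois_of_primeClass_eq_one_imp f hf R (fun v hv h1 => (hsplit v hv).mpr h1)
  have hcomm : ∀ a b : R ≃ₐ[K] R, Commute a b := commute_of_isAbelianGalois R
  have h𝔪 : Ideal.span {(f : 𝓞 K)} ≠ ⊥ := by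
    rw [Ne, Ideal.span_singleton_eq_bot]
    exact_mod_cast hf
  -- every `g` is a Frobenius at some `v ∤ f`
  have hex : ∀ g : R ≃ₐ[K] R, ∃ v : HeightOneSpectrum (𝓞 K), ¬ Ideal.span {(f : 𝓞 K)} ≤ v.asIdeal ∧
      galFrob K R v = g := fun g => by
    obtain ⟨v, hvS, -, -, hg⟩ := exists_galFrob_eq (K := K) R hcomm (finite_setOf_le_asIdeal h𝔪) g
    exact ⟨v, hvS, hg⟩
  choose q hq hqg using hex
  -- the characters `θ_χ` with `θ_χ(Frob_v) = χ([𝔭_v])`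
  choose Θ hΘ using fun χ : RingClassGroup K f →* ℂˣ =>
    exists_character_of_ringClassCharacter_galFrob f hf R hunr hsplit χ
  -- `[𝔭_v]` depends only on `Frob_v`
  have hwd : ∀ {v w : HeightOneSpectrum (𝓞 K)}, ¬ Ideal.span {(f : 𝓞 K)} ≤ v.asIdeal →
      ¬ Ideal.span {(f : 𝓞 K)} ≤ w.asIdeal → galFrob K R v = galFrob K R w →
      primeClass f v = primeClass f w := by
    intro v w hv hw hvw
    rw [← mul_inv_eq_one]
    refine eq_one_of_forall_character (RingClassGroup K f) _ fun χ => ?_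
    rw [map_mul, map_inv, ← hΘ χ v hv, ← hΘ χ w hw, hvw, mul_inv_cancel]
  -- the Artin map on elements
  set art₀ : (R ≃ₐ[K] R) → RingClassGroup K f := fun g => primeClass f (q g) with hart₀
  have hart₀_frob : ∀ v : HeightOneSpectrum (𝓞 K), ¬ Ideal.span {(f : 𝓞 K)} ≤ v.asIdeal →
      art₀ (galFrob K R v) = primeClass f v := fun v hv =>
    hwd (hq _) hv (hqg _)
  have hmul : ∀ a b, art₀ (a * b) = art₀ a * art₀ b := by
    intro a b
    rw [← mul_inv_eq_one]
    refine eq_one_of_forall_character (RingClassGroup K f) _ fun χ => ?_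
    rw [map_mul, map_inv, map_mul, hart₀, ← hΘ χ _ (hq (a * b)), ← hΘ χ _ (hq a), ← hΘ χ _ (hq b),
      hqg, hqg, hqg, map_mul, mul_inv_cancel]
  set artHom : (R ≃ₐ[K] R) →* RingClassGroup K f := MonoidHom.mk' art₀ hmul with hartHom
  -- injective by the splitting law
  have hinj : Function.Injective artHom := by
    rw [injective_iff_map_eq_one]
    intro g hg
    rw [hartHom, MonoidHom.mk'_apply, hart₀] at hg
    have hsplitq : q g ∈ splitPrimes K R := (hsplit _ (hq g)).mpr hg
    rw [← hqg g]
    exact (mem_splitPrimes_iff_galFrob_eq_one (hunr _ (hq g))).mp hsplitq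
  -- bijective by counting
  have hbij : Function.Bijective artHom := by
    haveI := Fintype.ofFinite (RingClassGroup K f)
    haveI := Fintype.ofFinite (R ≃ₐ[K] R)
    refine (Fintype.bijective_iff_injective_and_card artHom).mpr ⟨hinj, ?_⟩
    rw [← Nat.card_eq_fintype_card, ← Nat.card_eq_fintype_card,
      card_aut_eq_card_ringClassGroup_of_splitPrimes_iff f hf R hsplit]
  refine ⟨MulEquiv.ofBijective artHom hbij, fun v hv => ?_⟩
  rw [MulEquiv.ofBijective_apply, hartHom, MonoidHom.mk'_apply]
  exact hart₀_frob v hv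

/-- **The Artin isomorphism, absolute Frobenius currency**: with `R` as in `exists_artinEquiv` there
is `art : Gal(R/K) ≃* I_K(f)/P_{K,ℤ}(f)` with `art(σ|_R) = [𝔭_v]` for every `v ∤ f`, every prime
`𝔓 ∣ v` of `\bar ℤ_K` and every arithmetic Frobenius `σ ∈ Γ_K` at `𝔓`.
[cite: Cox2013, §9.A (pp. 180–181)] [cite: NeukirchANT1999, Ch. VI §7 Thm. (7.1)] -/
theorem exists_artinEquiv_abs (hf : f ≠ 0) (R : IntermediateField K (AlgebraicClosure K))
    [FiniteDimensional K R] [IsGalois K R] [NumberField R]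
    (hunr : ∀ v : HeightOneSpectrum (𝓞 K), ¬ Ideal.span {(f : 𝓞 K)} ≤ v.asIdeal →
      Algebra.IsUnramifiedIn (𝓞 R) v.asIdeal)
    (hsplit : ∀ v : HeightOneSpectrum (𝓞 K), ¬ Ideal.span {(f : 𝓞 K)} ≤ v.asIdeal →
      (v ∈ splitPrimes K R ↔ primeClass f v = 1)) :
    ∃ art : (R ≃ₐ[K] R) ≃* RingClassGroup K f, ∀ v : HeightOneSpectrum (𝓞 K),
      ¬ Ideal.span {(f : 𝓞 K)} ≤ v.asIdeal → ∀ 𝔓 ∈ v.primesAbove, ∀ σ : absoluteGaloisGroup K,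
        IsArithFrobAt (𝓞 K) σ 𝔓 → art (absRestrictNormalHom R σ) = primeClass f v := by
  classical
  haveI : IsAbelianGalois K R :=
    isAbelianGalois_of_primeClass_eq_one_imp f hf R (fun v hv h1 => (hsplit v hv).mpr h1)
  have hcomm : ∀ a b : R ≃ₐ[K] R, Commute a b := commute_of_isAbelianGalois R
  obtain ⟨art, hart⟩ := exists_artinEquiv f hf R hunr hsplit
  refine ⟨art, fun v hv 𝔓 h𝔓 σ hσ => ?_⟩
  haveI : 𝔓.IsPrime := h𝔓.1
  have hP := comap_ringOfIntegersToIntegralClosure_mem_primesOver_of_mem_primesAbove R h𝔓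
  have hrσ := isArithFrobAt_absRestrictNormalHom R hσ
  rw [eq_galFrob hcomm (hunr v hv) hP hrσ]
  exact hart v hv

end RingClassField

end Literature.NumberTheory.NumberFields

end
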